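import Mathlib.Algebra.QuadraticAlgebra.Basic
import Literature.NumberTheory.NumberFields.EisensteinFieldIntegers
import Mathlib.Tactic.Ring
import Mathlib.Tactic.Linarith
import Mathlib.Tactic.NormNum
import Mathlib.Tactic.IntervalCases
import HarnessLib

/-!
# Venture HSemireg — norm-one vectors of the split seed `SEED = (O_F², I)` are unit coordinate vectors; diagonal unitaries have
# order dividing `6`; the anti-diagonal antilinear structures are EVEN (ENGINE-W PROBE5 §37 (4) ∕ §53, LEMMA 53.1) — kernel arithmetic

HONEST FRAMING. Lean index of the computation cell `pub-hsemireg`, widening group ENGINE-W (code A, seat `engine-w-1`, gen 16).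
INTEGER ARITHMETIC in the coordinates of `O_F = ℤ[ω] ⊕ √−2·ℤ[ω]` (`ω² = −1 − ω`; `ℤ[ω] = QuadraticAlgebra ℤ (−1) (−1)` as in
`OrlovIsometryGroupCMQuadratic.lean`); no lattice class, abelian variety, sheaf, `Ext` group or semiregularity map is constructed;
nothing here says that HC, HC_CM or HC_AV holds. Theorems only (0 `def`, 0 named fact, 0 `sorry`).

SOURCE (the cell's own results): `widen/ENGINE-W/out/probe5/PROBE5-STIZ-A.md` §37 (4) (proof of THEOREM 37-C: «the seed `R₀²`
(`R₀ = O_K[√m]`) has unitary group the MONOMIAL group `μ(F) ≀ S₂` (a vector of h-norm 1 in `R₀²` has `|α|² + |β|² = 1` totally positive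
in `F⁺`, so it is a unit coordinate vector; `μ(F) = μ₆`), whose elements of order 3 are all DIAGONAL») and §53 LEMMA 53.1 (v5.0, file
`900af57992066e97`: «its 36 DIAGONAL elements `diag(u₁,u₂)` have orders in {1, 2, 3, 6}; every element of order 4 is ANTI-diagonal»;
«anti-diagonal ⟹ EVEN: `𝒫(u·c(z), z) = a(N(cz)) + a(Nz) = 2·a(Nz)`»). SETTING (m = −2, by value): `F = ℚ(ω, √−2)`, `F⁺ = ℚ(√6)`; for
`v = α + β√−2 ∈ O_F` (`α, β ∈ ℤ[ω]`) the relative norm is `N_{F∕F⁺}(v) = (|α|² + 2|β|²) − q·√6` with `|x + yω|² = x² − xy + y²` and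
`q ∈ ℤ` (the `ω`-coefficient of `βᾱ`); its RATIONAL PART `a(N v) = |α|² + 2|β|²` is what the hermitian norm-one condition constrains:
`h(v₁,v₂) = N(v₁) + N(v₂) = 1 ∈ F⁺` forces `a(N v₁) + a(N v₂) = 1` (and the `√6`-parts cancel). What the kernel holds:

* §1 **`eisNorm_eq_one_iff`** — the norm form `x² − xy + y²` of `ℤ[ω]` (non-negativity ∕ anisotropy are the tree's
  `Literature.NumberTheory.NumberFields.K3.norm_int_pos` ∕ `norm_int_eq_zero_iff`, reused) equals `1` exactly at the six units
  `±1, ±ω, ±(1 + ω) = ∓ω²` (coordinates `(1,0), (−1,0), (0,1), (0,−1), (1,1), (−1,−1)`).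
* §2 **`normOne_vector_is_unit_coordinate`** (LEMMA 53.1 (i) ∕ §37 (4), kernel form): if the rational parts satisfy
  `(|α₁|² + 2|β₁|²) + (|α₂|² + 2|β₂|²) = 1` then one coordinate `v_i = α_i + β_i√−2` VANISHES and the other has `β = 0`, `|α|² = 1` — a unit
  coordinate vector with entry in `μ₆`. (Hence a unitary matrix of SEED has unit-coordinate columns: `U(SEED) = μ₆ ≀ S₂`, by value.)
* §3 **`unit_pow_four_eq_one_imp_sq_eq_one`** — for the six units `u` of `ℤ[ω]`: `u⁴ = 1 ⟹ u² = 1`; so NO diagonal `diag(u₁,u₂)`, `u_i ∈ μ₆`,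
  has order `4` («every element of order 4 is anti-diagonal»), `unit_pow_six` (`u⁶ = 1`).
* §4 `star_coords` (`star (x + yω) = (x − y) − yω`) and **`antidiagonal_fixed_even`**: the rational part of `𝒩` on a fixed vector `(u·c(z), z)`
  of an anti-diagonal structure, `a(N(u·c z)) + a(N z)` with `|u|² = 1`, equals `2·a(N z)` — EVEN (LEMMA 53.1 (iii)).
WHAT IS NOT HERE: the hermitian∕module structure itself (SEED as an `O_F`-lattice, «unitary», «isometry» — by value), THEOREM 53's
two-case argument (prose, PROBE5 §53), LEMMA 53.2's two odd witnesses on `Λ(H, A)`.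
-/

namespace Summit.Ventures.HSemireg.SeedUnitary

open QuadraticAlgebra

/-! ## §1 The norm form of `ℤ[ω]` -/

/-! (The norm form `x² − xy + y²` of `ℤ[ω]` is non-negative and anisotropic: the tree's
`Literature.NumberTheory.NumberFields.K3.norm_int_pos` ∕ `norm_int_eq_zero_iff` — REUSED, not re-declared.) -/

/-- `x² − xy + y² = 1` exactly at the six units of `ℤ[ω]`: `(x, y) ∈ {(1,0), (−1,0), (0,1), (0,−1), (1,1), (−1,−1)}`
(`±1, ±ω, ±(1 + ω) = ∓ω²`). [kernel] -/
theorem eisNorm_eq_one_iff (x y : ℤ) : x ^ 2 - x * y + y ^ 2 = 1 ↔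
    (x = 1 ∧ y = 0) ∨ (x = -1 ∧ y = 0) ∨ (x = 0 ∧ y = 1) ∨ (x = 0 ∧ y = -1) ∨ (x = 1 ∧ y = 1) ∨ (x = -1 ∧ y = -1) := by
  constructor
  · intro h
    have h4 : 4 * (x ^ 2 - x * y + y ^ 2) = (2 * x - y) ^ 2 + 3 * y ^ 2 := by ring
    have hy : y ^ 2 ≤ 1 := by nlinarith [sq_nonneg (2 * x - y)]
    have hy' : -1 ≤ y ∧ y ≤ 1 := by
      constructor <;> nlinarith [sq_nonneg (y + 1), sq_nonneg (y - 1)]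
    have hx : x ^ 2 ≤ 2 := by nlinarith [sq_nonneg (2 * x - y), sq_nonneg (x - y)]
    have hx' : -1 ≤ x ∧ x ≤ 1 := by
      constructor <;> nlinarith [sq_nonneg (x + 1), sq_nonneg (x - 1)]
    obtain ⟨hy1, hy2⟩ := hy'
    obtain ⟨hx1, hx2⟩ := hx'
    interval_cases x <;> interval_cases y <;> simp_all
  · rintro (⟨rfl, rfl⟩ | ⟨rfl, rfl⟩ | ⟨rfl, rfl⟩ | ⟨rfl, rfl⟩ | ⟨rfl, rfl⟩ | ⟨rfl, rfl⟩) <;> norm_num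

/-! ## §2 Norm-one vectors of `SEED = O_F²` are unit coordinate vectors -/

/-- **LEMMA 53.1 (i) ∕ §37 (4), kernel form.** Write `v_i = α_i + β_i√−2 ∈ O_F` with `α_i = x_i + y_iω`, `β_i = z_i + w_iω ∈ ℤ[ω]`.
If the rational parts of the relative norms sum to one, `(|α₁|² + 2|β₁|²) + (|α₂|² + 2|β₂|²) = 1`, then EITHER `v₂ = 0` and `v₁ = α₁` is a
unit of `ℤ[ω]` (`β₁ = 0`, `|α₁|² = 1`), OR `v₁ = 0` and `v₂` is such a unit: a norm-one vector of `SEED` is a unit coordinate vector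
(so `U(SEED)` is monomial, `μ₆ ≀ S₂`). [kernel] -/
theorem normOne_vector_is_unit_coordinate (x₁ y₁ z₁ w₁ x₂ y₂ z₂ w₂ : ℤ)
    (h : (x₁ ^ 2 - x₁ * y₁ + y₁ ^ 2) + 2 * (z₁ ^ 2 - z₁ * w₁ + w₁ ^ 2)
        + ((x₂ ^ 2 - x₂ * y₂ + y₂ ^ 2) + 2 * (z₂ ^ 2 - z₂ * w₂ + w₂ ^ 2)) = 1) :
    (x₂ = 0 ∧ y₂ = 0 ∧ z₂ = 0 ∧ w₂ = 0 ∧ z₁ = 0 ∧ w₁ = 0 ∧ x₁ ^ 2 - x₁ * y₁ + y₁ ^ 2 = 1) ∨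
    (x₁ = 0 ∧ y₁ = 0 ∧ z₁ = 0 ∧ w₁ = 0 ∧ z₂ = 0 ∧ w₂ = 0 ∧ x₂ ^ 2 - x₂ * y₂ + y₂ ^ 2 = 1) := by
  have nn : ∀ a b : ℤ, 0 ≤ a ^ 2 - a * b + b ^ 2 := fun a b => by
    nlinarith [sq_nonneg (2 * a - b), sq_nonneg b]
  have n1 := nn x₁ y₁
  have n2 := nn z₁ w₁
  have n3 := nn x₂ y₂
  have n4 := nn z₂ w₂
  -- the two `β`'s vanish: `2·|β|² ≤ 1` forces `|β|² = 0`
  have hb1 : z₁ ^ 2 - z₁ * w₁ + w₁ ^ 2 = 0 := by omega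
  have hb2 : z₂ ^ 2 - z₂ * w₂ + w₂ ^ 2 = 0 := by omega
  obtain ⟨rfl, rfl⟩ := (Literature.NumberTheory.NumberFields.K3.norm_int_eq_zero_iff z₁ w₁).1 hb1
  obtain ⟨rfl, rfl⟩ := (Literature.NumberTheory.NumberFields.K3.norm_int_eq_zero_iff z₂ w₂).1 hb2
  -- the two `|α|²` are non-negative integers summing to `1`
  rcases (show x₁ ^ 2 - x₁ * y₁ + y₁ ^ 2 = 0 ∨ x₁ ^ 2 - x₁ * y₁ + y₁ ^ 2 = 1 by omega) with h0 | h1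
  · obtain ⟨rfl, rfl⟩ := (Literature.NumberTheory.NumberFields.K3.norm_int_eq_zero_iff x₁ y₁).1 h0
    right
    refine ⟨rfl, rfl, rfl, rfl, rfl, rfl, ?_⟩
    simpa using h
  · left
    have h2 : x₂ ^ 2 - x₂ * y₂ + y₂ ^ 2 = 0 := by omega
    obtain ⟨rfl, rfl⟩ := (Literature.NumberTheory.NumberFields.K3.norm_int_eq_zero_iff x₂ y₂).1 h2
    exact ⟨rfl, rfl, rfl, rfl, rfl, rfl, h1⟩

/-! ## §3 The units of `ℤ[ω]`: `u⁶ = 1`, and `u⁴ = 1 ⟹ u² = 1` (no diagonal unitary of order `4`) -/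

/-- The six units of `ℤ[ω]` as elements of `QuadraticAlgebra ℤ (−1) (−1)` all satisfy `u⁶ = 1`. [kernel] -/
theorem unit_pow_six (u : QuadraticAlgebra ℤ (-1) (-1))
    (hu : u = 1 ∨ u = -1 ∨ u = ω ∨ u = -ω ∨ u = ⟨1, 1⟩ ∨ u = ⟨-1, -1⟩) : u ^ 6 = 1 := by
  rcases hu with rfl | rfl | rfl | rfl | rfl | rfl <;>
    (ext <;> simp [pow_succ, omega])

/-- **No diagonal unitary of `SEED` has order `4`** (LEMMA 53.1 (i)): for a unit `u` of `ℤ[ω]`, `u⁴ = 1` forces `u² = 1` (`u = ±1`); hence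
`diag(u₁,u₂)⁴ = 1 ⟹ diag(u₁,u₂)² = 1`, and every order-4 element of `U(SEED) = μ₆ ≀ S₂` is anti-diagonal. [kernel] -/
theorem unit_pow_four_eq_one_imp_sq_eq_one (u : QuadraticAlgebra ℤ (-1) (-1))
    (hu : u = 1 ∨ u = -1 ∨ u = ω ∨ u = -ω ∨ u = ⟨1, 1⟩ ∨ u = ⟨-1, -1⟩) (h4 : u ^ 4 = 1) : u ^ 2 = 1 := by
  rcases hu with rfl | rfl | rfl | rfl | rfl | rfl
  · simp
  · norm_num
  · exfalso
    have := congrArg QuadraticAlgebra.im h4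
    simp [pow_succ, omega] at this
  · exfalso
    have := congrArg QuadraticAlgebra.im h4
    simp [pow_succ, omega] at this
  · exfalso
    have := congrArg QuadraticAlgebra.im h4
    simp [pow_succ] at this
  · exfalso
    have := congrArg QuadraticAlgebra.im h4
    simp [pow_succ] at this

/-! ## §4 The anti-diagonal antilinear structures are EVEN -/

/-- `star` on `ℤ[ω]` in coordinates (for the record: the cell's `c` acts on each `ℤ[ω]`-coordinate of `O_F` this way). [kernel] -/
theorem star_coords (x y : ℤ) : star (⟨x, y⟩ : QuadraticAlgebra ℤ (-1) (-1)) = ⟨x - y, -y⟩ := by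
  ext <;> simp [star_mk, sub_eq_add_neg]

/-- **LEMMA 53.1 (iii), kernel form.** On a fixed vector `(u·c(z), z)` of an anti-diagonal structure `[[0,u],[u,0]]∘c₀` the rational part
of the norm is `a(N(u·c z)) + a(N z)`; with `|u|² = 1` and `c(z) = ᾱ + β̄√−2` (`z = α + β√−2`, `α = x + yω`, `β = z₀ + wω`) this is
`(|ᾱ|² + 2|β̄|²) + (|α|² + 2|β|²) = 2·(|α|² + 2|β|²)` — an EVEN integer. [kernel] -/
theorem antidiagonal_fixed_even (x y z₀ w : ℤ) :
    Even ((((x - y) ^ 2 - (x - y) * (-y) + (-y) ^ 2) + 2 * ((z₀ - w) ^ 2 - (z₀ - w) * (-w) + (-w) ^ 2))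
      + ((x ^ 2 - x * y + y ^ 2) + 2 * (z₀ ^ 2 - z₀ * w + w ^ 2))) :=
  ⟨(x ^ 2 - x * y + y ^ 2) + 2 * (z₀ ^ 2 - z₀ * w + w ^ 2), by ring⟩

end Summit.Ventures.HSemireg.SeedUnitary
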